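import Literature.Analysis.FluidPDE.SlabPressureNormalization
import Literature.Analysis.FluidPDE.CKNEpsilonRegularityAssemblyProofs
import HarnessLib

/-!
# One-scale ε-regularity with the MEAN-FREE pressure quantity on a space–time slab

Analysis/FluidPDE proof file (theorems only; no definitions, no named facts). The tree's one-scale
criterion `Literature.Analysis.FluidPDE.oneScaleRegularity` (Caffarelli–Kohn–Nirenberg 1982, Prop. 1;
Robinson–Rodrigo–Sadowski 2016, Thm. 15.4; PROVED: `oneScaleRegularity_holds`) is stated with the RAW
pressure quantity `D(r; z) = r⁻² ∫∫_{Q_r(z)} |p|^{3/2}` (`cknD`). Claimed proofs built on the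
Caffarelli–Kohn–Nirenberg functional usually carry the OSCILLATION form
`P(r; z) = r⁻² ∫∫_{Q_r(z)} |p − [p]_{B_r(x₀)}(t)|^{3/2}` (`cknDOsc`; Lin 1998, §3; Albritton–Barker 2019, (1.6)),
which is what makes the functional invariant under the pressure's time-dependent constant. Since the
pressure of a suitable weak solution is determined only up to a function of time
(`IsSuitableWeakSolutionOn.sub_pressure`), the two criteria are equivalent on domains where the ball mean
`t ↦ [p]_{B_r(x₀)}(t)` is locally `L^{3/2}` — in particular on space–time SLABS `I × ℝ³`:

* `ballMean_class_of_isCompact_slab` — for a suitable weak solution on the slab `I × ℝ³` (`I` open) the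
  ball means `(t, x) ↦ [p]_{B(x₀, r)}(t)` are a.e.-strongly measurable and `L^{3/2}` on every compact subset
  of the slab (Jensen–Tonelli; the tree's `lintegral_enorm_setAverage_slice_rpow_le_of_subset`), generalising
  `unitBallMean_class_of_isCompact` (backward slab, unit ball at the origin);
* `IsSuitableWeakSolutionOn.sub_ballMean_slab` — `(u, p − [p]_{B(x₀,r)})` is again a suitable weak solution on
  the slab (generalising `IsSuitableWeakSolutionOn.sub_unitBallMean_slab`);
* `cknD_sub_ballMean` — the raw pressure quantity of the shifted pressure IS the oscillation quantity:
  `D(r; z)[p − [p]_{B_r(x₀)}] = P(r; z)[p]` (definitional);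
* `oneScaleRegularity_osc_slab` — **one-scale ε-regularity, oscillation form, on slabs**: there is an
  absolute `ε₀ > 0` such that for every suitable weak solution `(u, p)` (`ν = 1`, `f = 0`) on a slab
  `I × ℝ³` and every cylinder with `closure Q_r(z) ⊆ I × ℝ³`, `C(r; z) + P(r; z) ≤ ε₀` implies
  `u ∈ L^∞(Q_{r/2}(z))`.

## References
* [CaffarelliKohnNirenberg1982] L. Caffarelli, R. Kohn, L. Nirenberg, CPAM 35 (1982), Proposition 1 and
  its Corollary; §2 (the pressure is determined up to a function of time).
* [Lin1998] F. Lin, CPAM 51 (1998), §3 (the mean-free pressure quantity).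
-/

noncomputable section

open MeasureTheory Set Filter Function Metric TopologicalSpace
open scoped ENNReal NNReal Topology

namespace Literature.Analysis.FluidPDE

/-! ### Ball means of the slab pressure -/

section BallMean

variable {I : Set ℝ} {hI : IsOpen I}
  {u : ℝ → EuclideanSpace ℝ (Fin 3) → EuclideanSpace ℝ (Fin 3)}
  {p : ℝ → EuclideanSpace ℝ (Fin 3) → ℝ}

/-- **Compact subsets of a slab lie in compact cylinders `T × B̄(x₀, ρ)` of the slab** with
`T = fst '' K`, `ρ ≥ r` for any prescribed `r`, and `K ⊆ T × B(x₀, ρ)`. [folklore] -/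
private theorem exists_cylinder_of_isCompact_subset_slab' {K : Set (ℝ × EuclideanSpace ℝ (Fin 3))}
    (hK : IsCompact K) (hKs : K ⊆ I ×ˢ (univ : Set (EuclideanSpace ℝ (Fin 3))))
    (x₀ : EuclideanSpace ℝ (Fin 3)) (r : ℝ) :
    ∃ ρ : ℝ, r ≤ ρ ∧ K ⊆ (Prod.fst '' K) ×ˢ ball x₀ ρ ∧ IsCompact (Prod.fst '' K) ∧
      (Prod.fst '' K) ×ˢ closedBall x₀ ρ ⊆ I ×ˢ (univ : Set (EuclideanSpace ℝ (Fin 3))) := by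
  obtain ⟨ρ, hρr, hρ⟩ := (hK.image continuous_snd).isBounded.subset_ball_lt r x₀
  refine ⟨ρ, hρr.le, fun w hw => ⟨mem_image_of_mem _ hw, hρ (mem_image_of_mem _ hw)⟩,
    hK.image continuous_fst, ?_⟩
  rintro ⟨t, x⟩ ⟨⟨w, hw, hwt⟩, -⟩
  have h := hKs hw
  exact ⟨by rw [← hwt]; exact h.1, mem_univ _⟩

/-- **The ball means of the slab pressure are `L^{3/2}` on compact subsets of the slab.** For a suitable
weak solution `(u, p)` (`ν = 1`, `f = 0`) on the open slab `I × ℝ³` (so `p ∈ L^{3/2}_loc` there), a centre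
`x₀`, a radius `r > 0` and a compact `K` in the slab, the function `(t, x) ↦ [p]_{B(x₀,r)}(t) = ⨍_{B(x₀,r)} p(t,y) dy`
is a.e.-strongly measurable on `K` with `∫_K |[p]_{B(x₀,r)}(t)|^{3/2} < ∞` (Jensen–Tonelli on a cylinder
`T × B(x₀, ρ) ⊇ K` of the slab). Generalises `unitBallMean_class_of_isCompact`. [cite: CaffarelliKohnNirenberg1982, §2] -/
theorem ballMean_class_of_isCompact_slab
    (hsw : IsSuitableWeakSolutionOn (slab (EuclideanSpace ℝ (Fin 3)) I hI) 1 0 u p)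
    (x₀ : EuclideanSpace ℝ (Fin 3)) {r : ℝ} (hr : 0 < r)
    {K : Set (ℝ × EuclideanSpace ℝ (Fin 3))} (hK : IsCompact K)
    (hKs : K ⊆ I ×ˢ (univ : Set (EuclideanSpace ℝ (Fin 3)))) :
    AEStronglyMeasurable (fun z : ℝ × EuclideanSpace ℝ (Fin 3) => ⨍ y in ball x₀ r, p z.1 y)
        (volume.restrict K) ∧
      ∫⁻ z in K, ‖⨍ y in ball x₀ r, p z.1 y‖ₑ ^ (3 / 2 : ℝ) < ∞ := by
  obtain ⟨ρ, hρr, hKT, hTc, hTs⟩ := exists_cylinder_of_isCompact_subset_slab' hK hKs x₀ r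
  set T : Set ℝ := Prod.fst '' K with hT
  have hBS : ball x₀ r ⊆ ball x₀ ρ := ball_subset_ball hρr
  have hsub : T ×ˢ ball x₀ ρ ⊆ T ×ˢ closedBall x₀ ρ := prod_mono Subset.rfl ball_subset_closedBall
  have hK'c : IsCompact (T ×ˢ closedBall x₀ ρ) := hTc.prod (isCompact_closedBall _ _)
  have hli : LocallyIntegrableOn (uncurry p) (I ×ˢ (univ : Set (EuclideanSpace ℝ (Fin 3)))) volume :=
    hsw.distributional.2.2.1
  have hpm : AEStronglyMeasurable (uncurry p) (volume.restrict (T ×ˢ ball x₀ ρ)) :=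
    hli.aestronglyMeasurable.mono_measure (Measure.restrict_mono (hsub.trans hTs) le_rfl)
  -- measurability of the means on the cylinder
  have hmeas : AEStronglyMeasurable
      (fun z : ℝ × EuclideanSpace ℝ (Fin 3) => ⨍ y in ball x₀ r, p z.1 y)
      (volume.restrict (T ×ˢ ball x₀ ρ)) := by
    have hpB : AEStronglyMeasurable (uncurry p)
        ((volume.restrict T).prod (volume.restrict (ball x₀ r))) := by
      rw [← volume_restrict_prod_eq]
      exact hpm.mono_measure (Measure.restrict_mono (prod_mono Subset.rfl hBS) le_rfl)
    have h := hpB.integral_prod_right'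
    simp only [uncurry_apply_pair] at h
    have h' : AEStronglyMeasurable (fun t : ℝ => ⨍ y in ball x₀ r, p t y) (volume.restrict T) := by
      simp_rw [setAverage_eq]
      exact h.const_smul ((volume : Measure (EuclideanSpace ℝ (Fin 3))).real (ball x₀ r))⁻¹
    rw [volume_restrict_prod_eq]
    exact h'.comp_quasiMeasurePreserving Measure.quasiMeasurePreserving_fst
  refine ⟨hmeas.mono_measure (Measure.restrict_mono hKT le_rfl), ?_⟩
  have hJ := lintegral_enorm_setAverage_slice_rpow_le_of_subset (I := T)
    (measure_ball_lt_top (x := x₀) (r := r)).ne hBS (by norm_num : (1 : ℝ) ≤ 3 / 2) hpm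
  refine lt_of_le_of_lt (lintegral_mono_set hKT) (lt_of_le_of_lt hJ ?_)
  refine ENNReal.mul_lt_top (ENNReal.mul_lt_top measure_ball_lt_top
    (ENNReal.inv_lt_top.2 (measure_ball_pos volume x₀ hr))) ?_
  refine lt_of_le_of_lt (lintegral_mono_set ((prod_mono Subset.rfl hBS).trans hsub)) ?_
  exact hsw.pressure _ hTs hK'c

/-- **Normalising the pressure by a ball mean on a slab is harmless for suitability.** If `(u, p)` is a
suitable weak solution of Navier–Stokes (`ν = 1`, `f = 0`) on the slab `I × ℝ³`, so is
`(u, p − [p]_{B(x₀,r)})` for every centre `x₀` and radius `r > 0` (the shift is a function of time in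
`L^{3/2}_loc` of the slab; `IsSuitableWeakSolutionOn.sub_pressure`). Generalises
`IsSuitableWeakSolutionOn.sub_unitBallMean_slab`. [cite: CaffarelliKohnNirenberg1982, §2] -/
theorem IsSuitableWeakSolutionOn.sub_ballMean_slab
    (hsw : IsSuitableWeakSolutionOn (slab (EuclideanSpace ℝ (Fin 3)) I hI) 1 0 u p)
    (x₀ : EuclideanSpace ℝ (Fin 3)) {r : ℝ} (hr : 0 < r) :
    IsSuitableWeakSolutionOn (slab (EuclideanSpace ℝ (Fin 3)) I hI) 1 0 u
      (fun t x => p t x - ⨍ y in ball x₀ r, p t y) := by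
  refine hsw.sub_pressure ?_ fun K hKs hK => (ballMean_class_of_isCompact_slab hsw x₀ hr hK hKs).2
  refine (locallyIntegrableOn_iff
      (slab (EuclideanSpace ℝ (Fin 3)) I hI).isOpen.isLocallyClosed).2 fun K hKs hK => ?_
  obtain ⟨hm, hfin⟩ := ballMean_class_of_isCompact_slab hsw x₀ hr hK hKs
  obtain ⟨h32, h32', h32r⟩ := threeHalves_facts
  haveI : IsFiniteMeasure (volume.restrict K) := ⟨by
    rw [Measure.restrict_apply_univ]; exact hK.measure_lt_top⟩
  have hmem : MemLp (fun z : ℝ × EuclideanSpace ℝ (Fin 3) => ⨍ y in ball x₀ r, p z.1 y) (3 / 2)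
      (volume.restrict K) := by
    refine ⟨hm, ?_⟩
    rw [eLpNorm_eq_lintegral_rpow_enorm_toReal (zero_lt_one.trans_le h32).ne' h32', h32r]
    exact ENNReal.rpow_lt_top_of_nonneg (by positivity) hfin.ne
  exact hmem.integrable h32

end BallMean

/-! ### The oscillation form of the one-scale criterion -/

section Oscillation

/-- **The raw pressure quantity of the ball-mean-shifted pressure is the oscillation quantity**:
`D(r; z)[p − [p]_{B_r(x₀)}(t)] = P(r; z)[p]` (`cknD` vs `cknDOsc`; by definition). [cite: Lin1998] -/
theorem cknD_sub_ballMean (r : ℝ) (z : ℝ × EuclideanSpace ℝ (Fin 3))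
    (p : ℝ → EuclideanSpace ℝ (Fin 3) → ℝ) :
    cknD r z (fun t x => p t x - ⨍ y in ball z.2 r, p t y) = cknDOsc r z p := rfl

/-- **One-scale ε-regularity, oscillation form, on slabs** (Caffarelli–Kohn–Nirenberg 1982, Prop. 1, with
Lin's mean-free pressure quantity): there is an absolute `ε₀ > 0` such that for every suitable weak solution
`(u, p)` of the unforced unit-viscosity equations on a slab `I × ℝ³` (`I ⊆ ℝ` open) and every backward
cylinder with `closure Q_r(z) ⊆ I × ℝ³`, the smallness `C(r; z) + P(r; z) ≤ ε₀` of the cubic quantity and of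
the pressure OSCILLATION implies `u ∈ L^∞(Q_{r/2}(z))`. Proof: shift the pressure by its `B_r(x₀)`-mean
(`sub_ballMean_slab`), which turns `P` into `D` (`cknD_sub_ballMean`), and apply the tree's
`oneScaleRegularity_holds` with zero force. [cite: CaffarelliKohnNirenberg1982, Proposition 1 and Corollary]
[cite: Lin1998] -/
theorem oneScaleRegularity_osc_slab :
    ∃ ε₀ : ℝ, 0 < ε₀ ∧ ∀ (I : Set ℝ) (hI : IsOpen I)
      (u : ℝ → EuclideanSpace ℝ (Fin 3) → EuclideanSpace ℝ (Fin 3)) (p : ℝ → EuclideanSpace ℝ (Fin 3) → ℝ),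
      IsSuitableWeakSolutionOn (slab (EuclideanSpace ℝ (Fin 3)) I hI) 1 0 u p →
      ∀ (z : ℝ × EuclideanSpace ℝ (Fin 3)) (r : ℝ), 0 < r →
        closure (parabolicCylinder r z) ⊆ I ×ˢ (univ : Set (EuclideanSpace ℝ (Fin 3))) →
        cknC r z u + cknDOsc r z p ≤ ENNReal.ofReal ε₀ →
        eLpNorm (uncurry u) ∞ (volume.restrict (parabolicCylinder (r / 2) z)) < ∞ := by
  obtain ⟨ε₀, hε₀, H⟩ := oneScaleRegularity_holds
  obtain ⟨κ, hκ, H⟩ := H 3 (by norm_num)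
  refine ⟨ε₀, hε₀, fun I hI u p hsw z r hr hcl hsmall => ?_⟩
  -- shift the pressure by its ball mean at the centre of the cylinder
  have hsw' := hsw.sub_ballMean_slab z.2 hr
  have hf : MemLp (uncurry (0 : ℝ → EuclideanSpace ℝ (Fin 3) → EuclideanSpace ℝ (Fin 3)))
      (ENNReal.ofReal 3)
      (volume.restrict ((slab (EuclideanSpace ℝ (Fin 3)) I hI : Opens _) : Set (ℝ × EuclideanSpace ℝ (Fin 3)))) := by
    have e : uncurry (0 : ℝ → EuclideanSpace ℝ (Fin 3) → EuclideanSpace ℝ (Fin 3)) = 0 := rfl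
    rw [e]; exact MemLp.zero
  have hdiv : ∀ φ : ℝ → EuclideanSpace ℝ (Fin 3) → ℝ,
      IsSpaceTimeTestOn (slab (EuclideanSpace ℝ (Fin 3)) I hI) φ →
      ∫ t, ∫ x, inner ℝ ((0 : ℝ → EuclideanSpace ℝ (Fin 3) → EuclideanSpace ℝ (Fin 3)) t x)
        (gradient (φ t) x) = 0 := fun φ _ => by simp
  have hF : cknF 3 r z (0 : ℝ → EuclideanSpace ℝ (Fin 3) → EuclideanSpace ℝ (Fin 3)) ≤ ENNReal.ofReal κ := by
    have : cknF 3 r z (0 : ℝ → EuclideanSpace ℝ (Fin 3) → EuclideanSpace ℝ (Fin 3)) = 0 := by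
      simp [cknF, ENNReal.zero_rpow_of_pos (by norm_num : (0 : ℝ) < 3)]
    rw [this]; exact bot_le
  have hsmall' : cknC r z u + cknD r z (fun t x => p t x - ⨍ y in ball z.2 r, p t y) ≤ ENNReal.ofReal ε₀ := by
    rwa [cknD_sub_ballMean]
  exact H _ 0 u _ hsw' hf hdiv z r hr (by simpa only [coe_slab] using hcl) hsmall' hF

end Oscillation

end Literature.Analysis.FluidPDE

end
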